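import Mathlib.Analysis.Convex.Segment
import Mathlib.Analysis.Complex.Basic
import Literature.Probability.RandomPlanarGeometry.USTPeanoLattice
import HarnessLib

/-!
# Lattice geometry of the Peano grid: edges, half-diagonals, distances ([LSW04] §4.1)

G. F. Lawler, O. Schramm, W. Werner, Ann. Probab. **32** (2004), §4.1 (pp. 970–971) use,
without comment, the elementary plane geometry of the three lattices `ℤ²`, `(½ + ℤ)²`,
`(¼ + ℤ/2)²`: an edge of the Peano graph `G` (length `½`, between adjacent Peano vertices) meets
an edge of the primal or dual grid only by crossing it, meets one of the connecting segments
`[α_a, a]`, `[a, β_a]` only at the Peano vertex `a` (their midpoint), and two edges of `G` meet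
only in a common endpoint. This file PROVES these facts in coordinates (used in
`USTPeanoPathGeometry` to show that a Peano path runs inside its domain `D(α, β, a, b)` and is
a simple curve):

* `exists_of_mem_segment` — points of a segment of `ℂ` as `x + t (y - x)`;
* `quarter_le_dist_peanoPt_of_mem_primalEdge` / `…_dualEdge` — every point of a primal or dual
  lattice edge is at distance `≥ ¼` from every Peano vertex;
* `quarter_le_dist_peanoPt_of_mem_halfDiag` — a half-diagonal `[q, q ± (¼, ¼)]` at the Peano
  vertex `q` stays at distance `≥ ¼` from every other Peano vertex;
* `eq_of_mem_halfDiag_of_mem_peanoEdge` — a half-diagonal at `q` meets a Peano edge `[u, v]`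
  only at `q`, and only if `q ∈ {u, v}`;
* `mem_endpoints_of_mem_peanoEdge_inter` — two Peano edges meet only in a common endpoint
  (unless they are the same edge);
* `im_manhattan_step_mul_conj_diag` — the orientation identity: a Manhattan step `a → w` leaves
  `a` to the RIGHT of the oriented segment `[α_a, β_a]`
  (`im ((w - a) · conj(β_a - α_a)) = -¼`), and a Manhattan step `w → b` ARRIVES at `b` from the
  left of `[α_b, β_b]` (`= +¼`) — [LSW04] p. 971: "`D` lies to the immediate right of
  `[α_a, β_a]`".

## References

* G. F. Lawler, O. Schramm, W. Werner (2004), §4.1 [LawlerSchrammWerner2004].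
-/

noncomputable section

open Set Complex
open scoped ComplexConjugate

namespace Literature.Probability.RandomPlanarGeometry

namespace USTPeano

/-! ### Segments in coordinates -/

/-- A point of the segment `[x, y] ⊆ ℂ` is `x + t (y - x)` with `t ∈ [0, 1]`. [folklore] -/
theorem exists_of_mem_segment {x y z : ℂ} (hz : z ∈ segment ℝ x y) :
    ∃ t : ℝ, 0 ≤ t ∧ t ≤ 1 ∧ z = x + t * (y - x) := by
  rw [segment_eq_image_lineMap] at hz
  obtain ⟨t, ht, rfl⟩ := hz
  exact ⟨t, ht.1, ht.2, by rw [AffineMap.lineMap_apply_module', Complex.real_smul]; ring⟩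

/-- Conversely `x + t (y - x) ∈ [x, y]` for `t ∈ [0, 1]`. [folklore] -/
theorem add_mul_sub_mem_segment (x y : ℂ) {t : ℝ} (ht0 : 0 ≤ t) (ht1 : t ≤ 1) :
    x + t * (y - x) ∈ segment ℝ x y := by
  rw [segment_eq_image_lineMap]
  exact ⟨t, ⟨ht0, ht1⟩, by rw [AffineMap.lineMap_apply_module', Complex.real_smul]; ring⟩

/-- A lower bound on the real parts bounds the distance below. [folklore] -/
theorem le_dist_of_le_abs_re {z w : ℂ} {c : ℝ} (h : c ≤ |z.re - w.re|) : c ≤ dist z w :=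
  h.trans (by rw [← sub_re, dist_eq_norm]; exact abs_re_le_norm _)

/-- A lower bound on the imaginary parts bounds the distance below. [folklore] -/
theorem le_dist_of_le_abs_im {z w : ℂ} {c : ℝ} (h : c ≤ |z.im - w.im|) : c ≤ dist z w :=
  h.trans (by rw [← sub_im, dist_eq_norm]; exact abs_im_le_norm _)

/-- A nonzero integer divided by `4` has absolute value `≥ ¼`. [folklore] -/
theorem quarter_le_abs_of_ne_zero {N : ℤ} (hN : N ≠ 0) {x : ℝ} (hx : x = N / 4) : 1 / 4 ≤ |x| := by
  have h1 : (1 : ℝ) ≤ |(N : ℝ)| := by exact_mod_cast Int.one_le_abs hN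
  rw [hx, abs_div, abs_of_pos (by norm_num : (0 : ℝ) < 4)]
  linarith

/-! ### Distances from Peano vertices -/

/-- **Primal edges are `¼`-far from Peano vertices**: every point of a primal lattice edge
`[u, v]` (`u`, `v` adjacent in `ℤ²`) is at distance `≥ ¼` from every Peano vertex (a primal
edge lies on a line `x = m` or `y = n`, `m, n ∈ ℤ`, while Peano coordinates are `≡ ¼ mod ½`).
[cite: LawlerSchrammWerner2004, §4.1] -/
theorem quarter_le_dist_peanoPt_of_mem_primalEdge {u v : ℤ × ℤ} (h : LatticeAdj u v) (p : ℤ × ℤ)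
    {z : ℂ} (hz : z ∈ segment ℝ (primalPt u) (primalPt v)) : 1 / 4 ≤ dist z (peanoPt p) := by
  obtain ⟨t, -, -, rfl⟩ := exists_of_mem_segment hz
  rcases h with ⟨h1, -⟩ | ⟨h1, -⟩
  · refine le_dist_of_le_abs_re (quarter_le_abs_of_ne_zero (N := 4 * u.1 - 2 * p.1 - 1) (by omega) ?_)
    simp [h1]
    ring
  · refine le_dist_of_le_abs_im (quarter_le_abs_of_ne_zero (N := 4 * u.2 - 2 * p.2 - 1) (by omega) ?_)
    simp [h1]
    ring

/-- **Dual edges are `¼`-far from Peano vertices** (dual edges lie on lines `x = m + ½` or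
`y = n + ½`). [cite: LawlerSchrammWerner2004, §4.1] -/
theorem quarter_le_dist_peanoPt_of_mem_dualEdge {u v : ℤ × ℤ} (h : LatticeAdj u v) (p : ℤ × ℤ)
    {z : ℂ} (hz : z ∈ segment ℝ (dualPt u) (dualPt v)) : 1 / 4 ≤ dist z (peanoPt p) := by
  obtain ⟨t, -, -, rfl⟩ := exists_of_mem_segment hz
  rcases h with ⟨h1, -⟩ | ⟨h1, -⟩
  · refine le_dist_of_le_abs_re (quarter_le_abs_of_ne_zero (N := 4 * u.1 - 2 * p.1 + 1) (by omega) ?_)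
    simp [h1]
    ring
  · refine le_dist_of_le_abs_im (quarter_le_abs_of_ne_zero (N := 4 * u.2 - 2 * p.2 + 1) (by omega) ?_)
    simp [h1]
    ring

/-- **Half-diagonals are `¼`-far from the other Peano vertices**: if `c` is a primal or dual
vertex adjacent to the Peano vertex `q` (`|re (c - q)| = |im (c - q)| = ¼`), every point of
`[q, c]` is at distance `≥ ¼` from every Peano vertex `p ≠ q`. [cite: LawlerSchrammWerner2004, §4.1] -/
theorem quarter_le_dist_peanoPt_of_mem_halfDiag {q p : ℤ × ℤ} (hpq : p ≠ q) {c : ℂ}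
    (hc : |(c - peanoPt q).re| = 1 / 4 ∧ |(c - peanoPt q).im| = 1 / 4)
    {z : ℂ} (hz : z ∈ segment ℝ (peanoPt q) c) : 1 / 4 ≤ dist z (peanoPt p) := by
  obtain ⟨t, ht0, ht1, rfl⟩ := exists_of_mem_segment hz
  have hte : ∀ e : ℝ, |e| = 1 / 4 → |t * e| ≤ 1 / 4 := fun e he ↦ by
    rw [abs_mul, he, abs_of_nonneg ht0]; linarith
  by_cases h1 : p.1 = q.1
  · have h2 : p.2 ≠ q.2 := fun h2 ↦ hpq (Prod.ext h1 h2)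
    refine le_dist_of_le_abs_im ?_
    have hk : (1 : ℝ) ≤ |((q.2 - p.2 : ℤ) : ℝ)| := by exact_mod_cast Int.one_le_abs (by omega)
    have hexpr : (peanoPt q + t * (c - peanoPt q)).im - (peanoPt p).im =
        ((q.2 - p.2 : ℤ) : ℝ) / 2 + t * (c - peanoPt q).im := by
      simp; ring
    rw [hexpr]
    have := hte _ hc.2
    have h3 : |((q.2 - p.2 : ℤ) : ℝ) / 2| = |((q.2 - p.2 : ℤ) : ℝ)| / 2 := by
      rw [abs_div, abs_of_pos (by norm_num : (0 : ℝ) < 2)]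
    have h4 : |((q.2 - p.2 : ℤ) : ℝ) / 2| - |t * (c - peanoPt q).im| ≤
        |((q.2 - p.2 : ℤ) : ℝ) / 2 + t * (c - peanoPt q).im| := by
      have h5 := abs_sub_abs_le_abs_sub (((q.2 - p.2 : ℤ) : ℝ) / 2) (-(t * (c - peanoPt q).im))
      rwa [abs_neg, sub_neg_eq_add] at h5
    rw [h3] at h4
    linarith
  · refine le_dist_of_le_abs_re ?_
    have hk : (1 : ℝ) ≤ |((q.1 - p.1 : ℤ) : ℝ)| := by exact_mod_cast Int.one_le_abs (by omega)
    have hexpr : (peanoPt q + t * (c - peanoPt q)).re - (peanoPt p).re =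
        ((q.1 - p.1 : ℤ) : ℝ) / 2 + t * (c - peanoPt q).re := by
      simp; ring
    rw [hexpr]
    have := hte _ hc.1
    have h3 : |((q.1 - p.1 : ℤ) : ℝ) / 2| = |((q.1 - p.1 : ℤ) : ℝ)| / 2 := by
      rw [abs_div, abs_of_pos (by norm_num : (0 : ℝ) < 2)]
    have h4 : |((q.1 - p.1 : ℤ) : ℝ) / 2| - |t * (c - peanoPt q).re| ≤
        |((q.1 - p.1 : ℤ) : ℝ) / 2 + t * (c - peanoPt q).re| := by
      have h5 := abs_sub_abs_le_abs_sub (((q.1 - p.1 : ℤ) : ℝ) / 2) (-(t * (c - peanoPt q).re))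
      rwa [abs_neg, sub_neg_eq_add] at h5
    rw [h3] at h4
    linarith

/-! ### Intersections with Peano edges -/

/-- Arithmetic: `t e = k/2` with `t ∈ [0, 1]`, `|e| = ¼`, `k ∈ ℤ` forces `k = 0` and `t = 0`.
[folklore] -/
theorem eq_zero_of_mul_eq_half_int {k : ℤ} {t e : ℝ} (ht0 : 0 ≤ t) (ht1 : t ≤ 1)
    (he : |e| = 1 / 4) (h : t * e = k / 2) : k = 0 ∧ t = 0 := by
  have h1 : |t * e| ≤ 1 / 4 := by rw [abs_mul, he, abs_of_nonneg ht0]; linarith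
  rw [h, abs_div, abs_of_pos (by norm_num : (0 : ℝ) < 2)] at h1
  have h2 : |(k : ℝ)| < 1 := by linarith
  have hk : k = 0 := by
    have h3 := abs_lt.1 h2
    have h4 : (-1 : ℤ) < k := by exact_mod_cast h3.1
    have h5 : k < 1 := by exact_mod_cast h3.2
    omega
  refine ⟨hk, ?_⟩
  rw [hk, Int.cast_zero, zero_div] at h
  have he0 : e ≠ 0 := fun he0 ↦ by rw [he0, abs_zero] at he; norm_num at he
  exact (mul_eq_zero.1 h).resolve_right he0

/-- Arithmetic: an integer equal to `± s` with `s ∈ [0, 1]` is `0` (with `s = 0`) or `± 1`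
(with `s = 1`). [folklore] -/
theorem int_eq_of_eq_mul_unit {k δ : ℤ} {s : ℝ} (hs0 : 0 ≤ s) (hs1 : s ≤ 1) (hδ : δ = 1 ∨ δ = -1)
    (h : (k : ℝ) = s * δ) : (k = 0 ∧ s = 0) ∨ (k = δ ∧ s = 1) := by
  rcases hδ with rfl | rfl
  · simp only [Int.cast_one, mul_one] at h
    have h0 : (0 : ℝ) ≤ k := h ▸ hs0
    have h1 : (k : ℝ) ≤ 1 := h ▸ hs1
    have hk : 0 ≤ k ∧ k ≤ 1 := ⟨by exact_mod_cast h0, by exact_mod_cast h1⟩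
    rcases (show k = 0 ∨ k = 1 by omega) with rfl | rfl
    · left; exact ⟨rfl, by simpa using h.symm⟩
    · right; exact ⟨rfl, by simpa using h.symm⟩
  · simp only [Int.reduceNeg, Int.cast_neg, Int.cast_one, mul_neg, mul_one] at h
    have h0 : (k : ℝ) ≤ 0 := by rw [h]; linarith
    have h1 : (-1 : ℝ) ≤ k := by rw [h]; linarith
    have hk : -1 ≤ k ∧ k ≤ 0 := ⟨by exact_mod_cast h1, by exact_mod_cast h0⟩
    rcases (show k = 0 ∨ k = -1 by omega) with rfl | rfl
    · left; refine ⟨rfl, ?_⟩; simp at h; linarith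
    · right; refine ⟨rfl, ?_⟩; simp at h; linarith

/-- A Manhattan step changes exactly one coordinate by `± 1`. [folklore] -/
theorem manhattan_cases {u v : ℤ × ℤ} (h : Manhattan u v) :
    (∃ δ : ℤ, (δ = 1 ∨ δ = -1) ∧ v = (u.1 + δ, u.2)) ∨ (∃ δ : ℤ, (δ = 1 ∨ δ = -1) ∧ v = (u.1, u.2 + δ)) := by
  rcases h with ⟨rfl, -⟩ | ⟨rfl, -⟩ | ⟨rfl, -⟩ | ⟨rfl, -⟩
  · exact Or.inl ⟨1, Or.inl rfl, rfl⟩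
  · exact Or.inl ⟨-1, Or.inr rfl, by simp [sub_eq_add_neg]⟩
  · exact Or.inr ⟨1, Or.inl rfl, rfl⟩
  · exact Or.inr ⟨-1, Or.inr rfl, by simp [sub_eq_add_neg]⟩

/-- **A half-diagonal at `q` meets a Peano edge `[u, v]` only at `q`, and only if `q` is an
endpoint**: for `c` a primal/dual vertex adjacent to the Peano vertex `q`
(`|re (c - q)| = |im (c - q)| = ¼`) and a Manhattan edge `u → v`, every common point of `[q, c]`
and `[u, v]` is `q`, with `q = u` or `q = v` (the connecting segments `[α_a, β_a]`, `[α_b, β_b]`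
of [LSW04] p. 971 meet `G` only at `a`, `b`). [cite: LawlerSchrammWerner2004, §4.1] -/
theorem eq_of_mem_halfDiag_of_mem_peanoEdge {q u v : ℤ × ℤ} {c : ℂ}
    (hc : |(c - peanoPt q).re| = 1 / 4 ∧ |(c - peanoPt q).im| = 1 / 4) (huv : Manhattan u v)
    {z : ℂ} (hz1 : z ∈ segment ℝ (peanoPt q) c) (hz2 : z ∈ segment ℝ (peanoPt u) (peanoPt v)) :
    z = peanoPt q ∧ (q = u ∨ q = v) := by
  obtain ⟨t, ht0, ht1, rfl⟩ := exists_of_mem_segment hz1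
  obtain ⟨s, hs0, hs1, hzs⟩ := exists_of_mem_segment hz2
  have hre := congrArg Complex.re hzs
  have him := congrArg Complex.im hzs
  rcases manhattan_cases huv with ⟨δ, hδ, rfl⟩ | ⟨δ, hδ, rfl⟩
  · -- horizontal edge: the imaginary parts force `t = 0` and `q.2 = u.2`
    simp only [add_re, add_im, mul_re, mul_im, ofReal_re, ofReal_im, zero_mul, sub_zero,
      sub_re, sub_im, peanoPt_re, peanoPt_im, Int.cast_add] at hre him
    have him' : t * (c - peanoPt q).im = ((u.2 - q.2 : ℤ) : ℝ) / 2 := by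
      rw [sub_im, peanoPt_im]; push_cast; linarith
    obtain ⟨hk, rfl⟩ := eq_zero_of_mul_eq_half_int ht0 ht1 hc.2 him'
    have hq2 : q.2 = u.2 := by omega
    refine ⟨by simp, ?_⟩
    have hre' : ((q.1 - u.1 : ℤ) : ℝ) = s * δ := by push_cast; linarith
    rcases int_eq_of_eq_mul_unit hs0 hs1 hδ hre' with ⟨hk1, -⟩ | ⟨hk1, -⟩
    · left; exact Prod.ext (by omega) hq2
    · right; exact Prod.ext (by simp; omega) (by simp [hq2])
  · -- vertical edge
    simp only [add_re, add_im, mul_re, mul_im, ofReal_re, ofReal_im, zero_mul, sub_zero,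
      sub_re, sub_im, peanoPt_re, peanoPt_im, Int.cast_add] at hre him
    have hre' : t * (c - peanoPt q).re = ((u.1 - q.1 : ℤ) : ℝ) / 2 := by
      rw [sub_re, peanoPt_re]; push_cast; linarith
    obtain ⟨hk, rfl⟩ := eq_zero_of_mul_eq_half_int ht0 ht1 hc.1 hre'
    have hq1 : q.1 = u.1 := by omega
    refine ⟨by simp, ?_⟩
    have him' : ((q.2 - u.2 : ℤ) : ℝ) = s * δ := by push_cast; linarith
    rcases int_eq_of_eq_mul_unit hs0 hs1 hδ him' with ⟨hk1, -⟩ | ⟨hk1, -⟩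
    · left; exact Prod.ext hq1 (by omega)
    · right; exact Prod.ext (by simp [hq1]) (by simp; omega)

/-- Coordinates of a point of a horizontal Peano edge `[u, u + (δ, 0)]`. [folklore] -/
theorem coords_of_mem_peanoEdge_horizontal {u : ℤ × ℤ} {δ : ℤ} {z : ℂ}
    (hz : z ∈ segment ℝ (peanoPt u) (peanoPt (u.1 + δ, u.2))) :
    ∃ s : ℝ, 0 ≤ s ∧ s ≤ 1 ∧ z.re = u.1 / 2 + 1 / 4 + s * δ / 2 ∧ z.im = u.2 / 2 + 1 / 4 := by
  obtain ⟨s, hs0, hs1, rfl⟩ := exists_of_mem_segment hz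
  refine ⟨s, hs0, hs1, ?_, ?_⟩
  · simp; ring
  · simp

/-- Coordinates of a point of a vertical Peano edge `[u, u + (0, δ)]`. [folklore] -/
theorem coords_of_mem_peanoEdge_vertical {u : ℤ × ℤ} {δ : ℤ} {z : ℂ}
    (hz : z ∈ segment ℝ (peanoPt u) (peanoPt (u.1, u.2 + δ))) :
    ∃ s : ℝ, 0 ≤ s ∧ s ≤ 1 ∧ z.re = u.1 / 2 + 1 / 4 ∧ z.im = u.2 / 2 + 1 / 4 + s * δ / 2 := by
  obtain ⟨s, hs0, hs1, rfl⟩ := exists_of_mem_segment hz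
  refine ⟨s, hs0, hs1, ?_, ?_⟩
  · simp
  · simp; ring

/-- **Arithmetic of two collinear Peano edges.** Two unit steps on a lattice line, based at
integer distance `k` apart, with parameters `s, s' ∈ [0, 1]` describing a common point
(`s δ = k + s' δ'`, `δ, δ' = ± 1`): either the edges coincide (`k = 0`, `δ' = δ`), or they
coincide with opposite orientations (`k = δ`, `δ' = -δ`), or the common point is an endpoint of
both (`s, s' ∈ {0, 1}`). [folklore] -/
theorem collinear_peanoEdges {k δ δ' : ℤ} {s s' : ℝ} (hs0 : 0 ≤ s) (hs1 : s ≤ 1) (hs0' : 0 ≤ s')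
    (hs1' : s' ≤ 1) (hδ : δ = 1 ∨ δ = -1) (hδ' : δ' = 1 ∨ δ' = -1)
    (h : s * δ = k + s' * δ') :
    (k = 0 ∧ δ' = δ) ∨ (k = δ ∧ δ' = -δ) ∨ ((s = 0 ∨ s = 1) ∧ (s' = 0 ∨ s' = 1)) := by
  rcases hδ with rfl | rfl <;> rcases hδ' with rfl | rfl <;> push_cast at h
  · -- `s = k + s'`
    have h1 : (-1 : ℝ) ≤ k := by linarith
    have h2 : (k : ℝ) ≤ 1 := by linarith
    have h1' : (-1 : ℤ) ≤ k := by exact_mod_cast h1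
    have h2' : k ≤ 1 := by exact_mod_cast h2
    rcases (show k = 0 ∨ k = 1 ∨ k = -1 by omega) with rfl | rfl | rfl
    · exact Or.inl ⟨rfl, rfl⟩
    · push_cast at h
      exact Or.inr (Or.inr ⟨Or.inr (by linarith), Or.inl (by linarith)⟩)
    · push_cast at h
      exact Or.inr (Or.inr ⟨Or.inl (by linarith), Or.inr (by linarith)⟩)
  · -- `s = k - s'`
    have h1 : (0 : ℝ) ≤ k := by linarith
    have h2 : (k : ℝ) ≤ 2 := by linarith
    have h1' : (0 : ℤ) ≤ k := by exact_mod_cast h1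
    have h2' : k ≤ 2 := by exact_mod_cast h2
    rcases (show k = 0 ∨ k = 1 ∨ k = 2 by omega) with rfl | rfl | rfl
    · push_cast at h
      exact Or.inr (Or.inr ⟨Or.inl (by linarith), Or.inl (by linarith)⟩)
    · exact Or.inr (Or.inl ⟨rfl, rfl⟩)
    · push_cast at h
      exact Or.inr (Or.inr ⟨Or.inr (by linarith), Or.inr (by linarith)⟩)
  · -- `-s = k + s'`
    have h1 : (-2 : ℝ) ≤ k := by linarith
    have h2 : (k : ℝ) ≤ 0 := by linarith
    have h1' : (-2 : ℤ) ≤ k := by exact_mod_cast h1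
    have h2' : k ≤ 0 := by exact_mod_cast h2
    rcases (show k = 0 ∨ k = -1 ∨ k = -2 by omega) with rfl | rfl | rfl
    · push_cast at h
      exact Or.inr (Or.inr ⟨Or.inl (by linarith), Or.inl (by linarith)⟩)
    · exact Or.inr (Or.inl ⟨rfl, rfl⟩)
    · push_cast at h
      exact Or.inr (Or.inr ⟨Or.inr (by linarith), Or.inr (by linarith)⟩)
  · -- `-s = k - s'`
    have h1 : (-1 : ℝ) ≤ k := by linarith
    have h2 : (k : ℝ) ≤ 1 := by linarith
    have h1' : (-1 : ℤ) ≤ k := by exact_mod_cast h1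
    have h2' : k ≤ 1 := by exact_mod_cast h2
    rcases (show k = 0 ∨ k = 1 ∨ k = -1 by omega) with rfl | rfl | rfl
    · exact Or.inl ⟨rfl, rfl⟩
    · push_cast at h
      exact Or.inr (Or.inr ⟨Or.inl (by linarith), Or.inr (by linarith)⟩)
    · push_cast at h
      exact Or.inr (Or.inr ⟨Or.inr (by linarith), Or.inl (by linarith)⟩)

/-- **Two Peano edges meet only in a common endpoint** (or coincide): for Manhattan edges
`u → v`, `u' → v'` and a common point `z` of `[u, v]` and `[u', v']`, either `z` is an endpoint
of both, or the two edges have the same endpoints. (The edges of the square grid `(¼ + ℤ/2)²`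
form a planar straight-line graph.) [cite: LawlerSchrammWerner2004, §4.1] -/
theorem mem_endpoints_of_mem_peanoEdge_inter {u v u' v' : ℤ × ℤ} (h : Manhattan u v)
    (h' : Manhattan u' v') {z : ℂ} (hz : z ∈ segment ℝ (peanoPt u) (peanoPt v))
    (hz' : z ∈ segment ℝ (peanoPt u') (peanoPt v')) :
    ((z = peanoPt u ∨ z = peanoPt v) ∧ (z = peanoPt u' ∨ z = peanoPt v')) ∨
      ({u, v} : Set (ℤ × ℤ)) = {u', v'} := by
  rcases manhattan_cases h with ⟨δ, hδ, rfl⟩ | ⟨δ, hδ, rfl⟩ <;>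
    rcases manhattan_cases h' with ⟨δ', hδ', rfl⟩ | ⟨δ', hδ', rfl⟩
  · -- horizontal / horizontal
    obtain ⟨s, hs0, hs1, hre, him⟩ := coords_of_mem_peanoEdge_horizontal hz
    obtain ⟨s', hs0', hs1', hre', him'⟩ := coords_of_mem_peanoEdge_horizontal hz'
    have h2 : u'.2 = u.2 := by
      have : (u'.2 : ℝ) = u.2 := by linarith
      exact_mod_cast this
    have hrel : s * δ = ((u'.1 - u.1 : ℤ) : ℝ) + s' * δ' := by push_cast; linarith
    rcases collinear_peanoEdges hs0 hs1 hs0' hs1' hδ hδ' hrel with ⟨hk, hδδ⟩ | ⟨hk, hδδ⟩ | ⟨hs, hs'⟩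
    · right
      have hu : u' = u := Prod.ext (by omega) h2
      subst hu; subst hδδ; rfl
    · right
      have hu : u' = (u.1 + δ, u.2) := Prod.ext (by omega) (by simpa using h2)
      subst hδδ
      have hv' : (u'.1 + -δ, u'.2) = u := by rw [hu]; exact Prod.ext (by push_cast; ring) rfl
      rw [hv', hu, Set.pair_comm]
    · left
      constructor
      · rcases hs with rfl | rfl
        · left; exact Complex.ext (by rw [hre, peanoPt_re]; ring) him
        · right; exact Complex.ext (by rw [hre, peanoPt_re]; push_cast; ring) him
      · rcases hs' with rfl | rfl
        · left; exact Complex.ext (by rw [hre', peanoPt_re]; ring) him'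
        · right; exact Complex.ext (by rw [hre', peanoPt_re]; push_cast; ring) him'
  · -- horizontal / vertical: the crossing point is a lattice point of both
    obtain ⟨s, hs0, hs1, hre, him⟩ := coords_of_mem_peanoEdge_horizontal hz
    obtain ⟨s', hs0', hs1', hre', him'⟩ := coords_of_mem_peanoEdge_vertical hz'
    have h1 : ((u'.1 - u.1 : ℤ) : ℝ) = s * δ := by push_cast; linarith
    have h2 : ((u.2 - u'.2 : ℤ) : ℝ) = s' * δ' := by push_cast; linarith
    left
    constructor
    · rcases int_eq_of_eq_mul_unit hs0 hs1 hδ h1 with ⟨-, rfl⟩ | ⟨-, rfl⟩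
      · left; exact Complex.ext (by rw [hre, peanoPt_re]; ring) him
      · right; exact Complex.ext (by rw [hre, peanoPt_re]; push_cast; ring) him
    · rcases int_eq_of_eq_mul_unit hs0' hs1' hδ' h2 with ⟨-, rfl⟩ | ⟨-, rfl⟩
      · left; exact Complex.ext hre' (by rw [him', peanoPt_im]; ring)
      · right; exact Complex.ext hre' (by rw [him', peanoPt_im]; push_cast; ring)
  · -- vertical / horizontal
    obtain ⟨s, hs0, hs1, hre, him⟩ := coords_of_mem_peanoEdge_vertical hz
    obtain ⟨s', hs0', hs1', hre', him'⟩ := coords_of_mem_peanoEdge_horizontal hz'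
    have h1 : ((u.1 - u'.1 : ℤ) : ℝ) = s' * δ' := by push_cast; linarith
    have h2 : ((u'.2 - u.2 : ℤ) : ℝ) = s * δ := by push_cast; linarith
    left
    constructor
    · rcases int_eq_of_eq_mul_unit hs0 hs1 hδ h2 with ⟨-, rfl⟩ | ⟨-, rfl⟩
      · left; exact Complex.ext hre (by rw [him, peanoPt_im]; ring)
      · right; exact Complex.ext hre (by rw [him, peanoPt_im]; push_cast; ring)
    · rcases int_eq_of_eq_mul_unit hs0' hs1' hδ' h1 with ⟨-, rfl⟩ | ⟨-, rfl⟩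
      · left; exact Complex.ext (by rw [hre', peanoPt_re]; ring) him'
      · right; exact Complex.ext (by rw [hre', peanoPt_re]; push_cast; ring) him'
  · -- vertical / vertical
    obtain ⟨s, hs0, hs1, hre, him⟩ := coords_of_mem_peanoEdge_vertical hz
    obtain ⟨s', hs0', hs1', hre', him'⟩ := coords_of_mem_peanoEdge_vertical hz'
    have h1 : u'.1 = u.1 := by
      have : (u'.1 : ℝ) = u.1 := by linarith
      exact_mod_cast this
    have hrel : s * δ = ((u'.2 - u.2 : ℤ) : ℝ) + s' * δ' := by push_cast; linarith
    rcases collinear_peanoEdges hs0 hs1 hs0' hs1' hδ hδ' hrel with ⟨hk, hδδ⟩ | ⟨hk, hδδ⟩ | ⟨hs, hs'⟩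
    · right
      have hu : u' = u := Prod.ext h1 (by omega)
      subst hu; subst hδδ; rfl
    · right
      have hu : u' = (u.1, u.2 + δ) := Prod.ext (by simpa using h1) (by omega)
      subst hδδ
      have hv' : (u'.1, u'.2 + -δ) = u := by rw [hu]; exact Prod.ext rfl (by push_cast; ring)
      rw [hv', hu, Set.pair_comm]
    · left
      constructor
      · rcases hs with rfl | rfl
        · left; exact Complex.ext hre (by rw [him, peanoPt_im]; ring)
        · right; exact Complex.ext hre (by rw [him, peanoPt_im]; push_cast; ring)
      · rcases hs' with rfl | rfl
        · left; exact Complex.ext hre' (by rw [him', peanoPt_im]; ring)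
        · right; exact Complex.ext hre' (by rw [him', peanoPt_im]; push_cast; ring)

/-! ### The connecting diagonal `β_a - α_a` and the Manhattan orientation -/

/-- Real part of the connecting vector `β_p - α_p` (from the primal to the dual neighbour of the
Peano vertex `p`): `± ½` according to the parity of the first index. [folklore] -/
theorem re_dualPt_sub_primalPt (p : ℤ × ℤ) :
    (dualPt (dualNbr p) - primalPt (primalNbr p)).re = if Even p.1 then 1 / 2 else -(1 / 2) := by
  have h1 := half_add_quarter_sub_primal p.1
  have h2 := half_add_quarter_sub_dual p.1
  simp only [sub_re, dualPt_re, primalPt_re, dualNbr, primalNbr] at h1 h2 ⊢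
  split_ifs at h1 h2 ⊢ <;> linarith

/-- Imaginary part of `β_p - α_p`: `± ½` according to the parity of the second index. [folklore] -/
theorem im_dualPt_sub_primalPt (p : ℤ × ℤ) :
    (dualPt (dualNbr p) - primalPt (primalNbr p)).im = if Even p.2 then 1 / 2 else -(1 / 2) := by
  have h1 := half_add_quarter_sub_primal p.2
  have h2 := half_add_quarter_sub_dual p.2
  simp only [sub_im, dualPt_im, primalPt_im, dualNbr, primalNbr] at h1 h2 ⊢
  split_ifs at h1 h2 ⊢ <;> linarith

/-- `|β_p - α_p|² = ½`. [folklore] -/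
theorem normSq_dualPt_sub_primalPt (p : ℤ × ℤ) :
    Complex.normSq (dualPt (dualNbr p) - primalPt (primalNbr p)) = 1 / 2 := by
  rw [Complex.normSq_apply, re_dualPt_sub_primalPt, im_dualPt_sub_primalPt]
  split_ifs <;> norm_num

/-- `β_p ≠ α_p`. [folklore] -/
theorem dualPt_sub_primalPt_ne_zero (p : ℤ × ℤ) : dualPt (dualNbr p) - primalPt (primalNbr p) ≠ 0 := by
  intro h
  have := normSq_dualPt_sub_primalPt p
  rw [h, map_zero] at this
  norm_num at this

/-- `p - α_p = (β_p - α_p)/2` (`p` is the midpoint of `[α_p, β_p]`). [folklore] -/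
theorem peanoPt_sub_primalPt_eq (p : ℤ × ℤ) :
    peanoPt p - primalPt (primalNbr p) = (dualPt (dualNbr p) - primalPt (primalNbr p)) / 2 := by
  rw [peanoPt_eq_midpoint p]; ring

/-- `β_p - p = (β_p - α_p)/2`. [folklore] -/
theorem dualPt_sub_peanoPt_eq (p : ℤ × ℤ) :
    dualPt (dualNbr p) - peanoPt p = (dualPt (dualNbr p) - primalPt (primalNbr p)) / 2 := by
  rw [peanoPt_eq_midpoint p]; ring

/-- The half-diagonal data of the primal neighbour: `|re (α_p - p)| = |im (α_p - p)| = ¼`.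
[folklore] -/
theorem abs_primalPt_sub_peanoPt (p : ℤ × ℤ) :
    |(primalPt (primalNbr p) - peanoPt p).re| = 1 / 4 ∧ |(primalPt (primalNbr p) - peanoPt p).im| = 1 / 4 := by
  have h := abs_re_peanoPt_sub_primalPt p
  rw [← neg_sub, neg_re, neg_im, abs_neg, abs_neg]
  exact h

/-- The half-diagonal data of the dual neighbour: `|re (β_p - p)| = |im (β_p - p)| = ¼`.
[folklore] -/
theorem abs_dualPt_sub_peanoPt (p : ℤ × ℤ) :
    |(dualPt (dualNbr p) - peanoPt p).re| = 1 / 4 ∧ |(dualPt (dualNbr p) - peanoPt p).im| = 1 / 4 := by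
  have h := abs_re_peanoPt_sub_dualPt p
  rw [← neg_sub, neg_re, neg_im, abs_neg, abs_neg]
  exact h

/-- **The Manhattan orientation leaves every vertex to the right of its connecting diagonal**:
for a Manhattan step `a → w`, `im ((w - a) conj(β_a - α_a)) = -¼ < 0`, i.e. `w` lies strictly
on the right of the oriented line through `α_a, β_a` — the same side as the test point
`a - ¼ i (β_a - α_a)` of `USTPeano.rightTestPt` ([LSW04] p. 971: "`D` lies to the immediate
right of `[α_a, β_a]`"; both edges of `G⃗` leaving `a` enter `D`). [cite: LawlerSchrammWerner2004, §4.1] -/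
theorem im_manhattan_step_mul_conj_diag {a w : ℤ × ℤ} (h : Manhattan a w) :
    ((peanoPt w - peanoPt a) * conj (dualPt (dualNbr a) - primalPt (primalNbr a))).im = -(1 / 4) := by
  have hre := re_dualPt_sub_primalPt a
  have him := im_dualPt_sub_primalPt a
  rw [mul_im, conj_re, conj_im, hre, him]
  rcases h with ⟨rfl, h2⟩ | ⟨rfl, h2⟩ | ⟨rfl, h1⟩ | ⟨rfl, h1⟩
  · rw [if_pos h2]; simp; ring
  · rw [if_neg (Int.not_even_iff_odd.2 h2)]; simp; ring
  · rw [if_neg (Int.not_even_iff_odd.2 h1)]; simp; ring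
  · rw [if_pos h1]; simp; ring

/-- **A Manhattan step `w → b` arrives from the left of the diagonal at its endpoint**:
`im ((w - b) conj(β_b - α_b)) = +¼ > 0` (the parities of `b` are those of `w` with the stepped
coordinate flipped). [cite: LawlerSchrammWerner2004, §4.1] -/
theorem im_manhattan_step_mul_conj_diag_target {w b : ℤ × ℤ} (h : Manhattan w b) :
    ((peanoPt w - peanoPt b) * conj (dualPt (dualNbr b) - primalPt (primalNbr b))).im = 1 / 4 := by
  have hre := re_dualPt_sub_primalPt b
  have him := im_dualPt_sub_primalPt b
  rw [mul_im, conj_re, conj_im, hre, him]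
  rcases h with ⟨rfl, h2⟩ | ⟨rfl, h2⟩ | ⟨rfl, h1⟩ | ⟨rfl, h1⟩
  · simp only at *
    rw [if_pos h2]; simp; ring
  · simp only at *
    rw [if_neg (Int.not_even_iff_odd.2 h2)]; simp; ring
  · simp only at *
    have : ¬ Even w.1 := Int.not_even_iff_odd.2 h1
    rw [if_neg this]; simp; ring
  · simp only at *
    rw [if_pos h1]; simp; ring

end USTPeano

end Literature.Probability.RandomPlanarGeometry
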